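import Mathlib.Data.ZMod.Basic
import Mathlib.Algebra.Order.BigOperators.Ring.Finset
import Mathlib.Analysis.SpecialFunctions.Pow.Real
import Mathlib.Analysis.SpecialFunctions.Log.Basic
import Literature.Combinatorics.Additive.TightTriangleRemoval
import Literature.Combinatorics.Additive.TightTriangleRemovalProofs
import HarnessLib

/-!
# Pratt's packing argument (Cor. 2.9 / 2.10), corrected: the sum-of-minima bound for STPP families
# in `𝔽_p^ℓ`, conditional on Fox–Lovász tight triangle removal

Topic `Literature/Combinatorics/Additive` (family `MatrixMultiplication`). Companion of
`TightTriangleRemoval.lean` (named facts `FoxLovasz2017_thm1`, `Pratt2024_cor210`) and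
`TightTriangleRemovalProofs.lean` (where `Pratt2024_cor210` — "one of the three full packing sums
is `≤ K (q/γ)^ℓ`" — is REFUTED by a three-block family).

Source: K. Pratt, *On generalized corners and matrix multiplication*, ITCS 2024
(arXiv:2309.03878), §2.1, proof of Cor. 2.9 and Cor. 2.10 (p. 6). This file formalises the
printed argument with its one gap repaired, which changes the conclusion from the (false)
disjunction over the three full packing sums to a bound on the **sum over blocks of the minimum of
the three pair products**:

* (Pratt, proof of Cor. 2.9, first paragraph) for an STPP family `(Aᵢ, Bᵢ, Cᵢ)` in `G`, `|G| = n`,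
  the sets `D₁ = ⊔ᵢ (Aᵢ − Bᵢ)`, `D₂ = ⊔ᵢ (Bᵢ − Cᵢ)`, `D₃ = ⊔ᵢ (Cᵢ − Aᵢ)` carry at most
  `Σᵢ |Aᵢ||Bᵢ||Cᵢ|` solutions of `d₁ + d₂ + d₃ = 0` (`card_triangles_le`, by the STPP), and
  `Σᵢ |Aᵢ||Bᵢ||Cᵢ| ≤ n^{3/2}` by the packing bounds and Cauchy–Schwarz
  (`sq_sum_card_mul_le`; packing bound `sum_card_badPairs_le` with `R = G`);
* (ibid., second paragraph, the single-block density argument — here in its sharp union-bound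
  form) if a set `R ⊆ G` meets every solution with `d₁ ∈ Aᵢ − Bᵢ`, `d₂ ∈ Bᵢ − Cᵢ`, `d₃ ∈ Cᵢ − Aᵢ`
  of ONE block, then `|Aᵢ||Bᵢ||Cᵢ| ≤ |Cᵢ|β₁ + |Aᵢ|β₂ + |Bᵢ|β₃` with `β₁, β₂, β₃` the numbers of pairs
  whose difference lies in `R` (`card_mul_le_of_forall_mem`), whence
  `min(|Aᵢ||Bᵢ|, |Bᵢ||Cᵢ|, |Cᵢ||Aᵢ|) ≤ β₁ + β₂ + β₃` (`min_le_card_badPairs`); summing over blocks and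
  using that `(i, a, b) ↦ a − b` is injective on `⊔ᵢ Aᵢ × Bᵢ` (STPP), a removal set `R` for
  `(D₁, D₂, D₃)` satisfies `Σᵢ min(…) ≤ 3|R|` (`sum_min_le_three_mul_card`). [The printed proof
  instead pigeonholes a common good block for three subsets of density `0.9999` — valid for
  uniform families only; see `TightTriangleRemovalProofs.lean`.]
* (Pratt, proof of Cor. 2.10) with `δ = n^{−1/2}`-few solutions, tight removal in `𝔽_p^ℓ`
  (Fox–Lovász 2017, Thm. 1: `δ = (ε/3)^{C_p}`, `C_p = 1 + 1/c_p = Θ(log p)`) removes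
  `εn = 3·(2/√n)^{1/C_p}·n ≤ 6 n^{1 − 1/(2C_p)}` elements, and `n^{−1/(2C_p)} = (p^{−1/(2C_p)})^ℓ ≤ γ^{−ℓ}`
  with the absolute `γ = exp(δ₀ log 2 / (2(δ₀ + log 2))) > 1`, `δ₀ = log((2/3)2^{2/3})` the BCCGNSU
  constant (`c_p ≥ δ₀/log p`, proved in `TightTriangleRemoval.lean`); small `ℓ ≤ L₀` (where `ε ≥ 1`)
  are covered by the packing bound with `K ≥ γ^{L₀}`.

Main result: `sum_min_packing_le_of_foxLovasz` — **assuming `FoxLovasz2017_thm1`** (a named fact of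
the tree, Fox–Lovász's Thm. 1 as printed, primes only), there are absolute `γ > 1`, `K` with
`Σᵢ min(|Aᵢ||Bᵢ|, |Bᵢ||Cᵢ|, |Cᵢ||Aᵢ|) ≤ K (p/γ)^ℓ` for every prime `p`, every `ℓ` and every STPP family
in `𝔽_p^ℓ`; for UNIFORM families this gives the printed disjunction of Cor. 2.10
(`packing_disj_of_uniform_of_foxLovasz`). The prime-power case asserted in Pratt's footnote 1
would follow verbatim from a prime-power removal lemma, which is not in print and not vendored.

## References

* [Pratt2024] K. Pratt, *On generalized corners and matrix multiplication*, ITCS 2024, LIPIcs 287,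
  89:1–17; arXiv:2309.03878 — proof of Cor. 2.9, Cor. 2.10 (p. 6).
* [FoxLovasz2017] J. Fox, L. M. Lovász, *A tight bound for Green's arithmetic triangle removal lemma
  in vector spaces*, SODA 2017 — Thm. 1.
* [BlasiakChurchCohnGrochowNaslundSawinUmans2017] J. Blasiak et al., *On cap sets and the
  group-theoretic approach to matrix multiplication*, Discrete Analysis 2017:3 — Thm. A′ (the
  constant `δ₀`), §2 (packing bounds).
-/

noncomputable section

open Finset
open scoped BigOperators

namespace Literature.Combinatorics.Additive

open Literature.Computability.AlgebraicComplexity (IsSTPP)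
open Literature.Barriers.MatrixMultiplication (bccgnsuDelta bccgnsuDelta_pos)

/-! ### Pairs with difference in `R`, and the single-block union bound -/

section Blocks

variable {G : Type*} [AddCommGroup G] [DecidableEq G]

/-- The pairs `(x, y) ∈ X × Y` whose difference `x − y` lies in `R` ("bad pairs": the edge `xy` of
Pratt's tripartite graph is deleted when `x − y` is removed). [cite: Pratt2024, Cor. 2.9 (proof)] -/
def badPairs (R X Y : Finset G) : Finset (G × G) :=
  (X ×ˢ Y).filter fun q => q.1 - q.2 ∈ R

/-- Membership in `badPairs`. [folklore] -/
theorem mem_badPairs {R X Y : Finset G} {q : G × G} :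
    q ∈ badPairs R X Y ↔ (q.1 ∈ X ∧ q.2 ∈ Y) ∧ q.1 - q.2 ∈ R := by
  simp [badPairs, Finset.mem_filter, Finset.mem_product]

/-- With `R = G` every pair is bad: `badPairs univ X Y = X × Y`. [folklore] -/
theorem badPairs_univ [Fintype G] (X Y : Finset G) : badPairs Finset.univ X Y = X ×ˢ Y := by
  simp [badPairs]

/-- **Single-block union bound** (the sharp form of the density step in Pratt's proof of Cor. 2.9):
if every triple `(x, y, z) ∈ X × Y × Z` has one of its three differences `x − y`, `y − z`, `z − x`
in `R`, then `|X||Y||Z| ≤ |Z|·β(X,Y) + |X|·β(Y,Z) + |Y|·β(Z,X)`, `β` counting bad pairs (each bad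
pair lies in as many triples as the third set has elements). [cite: Pratt2024, Cor. 2.9 (proof)] -/
theorem card_mul_le_of_forall_mem (R X Y Z : Finset G)
    (h : ∀ x ∈ X, ∀ y ∈ Y, ∀ z ∈ Z, x - y ∈ R ∨ y - z ∈ R ∨ z - x ∈ R) :
    X.card * Y.card * Z.card ≤
      Z.card * (badPairs R X Y).card + X.card * (badPairs R Y Z).card +
        Y.card * (badPairs R Z X).card := by
  classical
  set S₁ : Finset (G × G × G) :=
    ((badPairs R X Y) ×ˢ Z).image fun q : (G × G) × G => (q.1.1, q.1.2, q.2) with hS₁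
  set S₂ : Finset (G × G × G) := X ×ˢ badPairs R Y Z with hS₂
  set S₃ : Finset (G × G × G) :=
    ((badPairs R Z X) ×ˢ Y).image fun q : (G × G) × G => (q.1.2, q.2, q.1.1) with hS₃
  have hsub : X ×ˢ Y ×ˢ Z ⊆ S₁ ∪ S₂ ∪ S₃ := by
    rintro ⟨x, y, z⟩ hxyz
    simp only [Finset.mem_product] at hxyz
    obtain ⟨hx, hy, hz⟩ := hxyz
    rcases h x hx y hy z hz with h1 | h2 | h3
    · refine Finset.mem_union_left _ (Finset.mem_union_left _ ?_)
      rw [hS₁, Finset.mem_image]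
      exact ⟨((x, y), z), Finset.mem_product.2 ⟨mem_badPairs.2 ⟨⟨hx, hy⟩, h1⟩, hz⟩, rfl⟩
    · refine Finset.mem_union_left _ (Finset.mem_union_right _ ?_)
      rw [hS₂, Finset.mem_product]
      exact ⟨hx, mem_badPairs.2 ⟨⟨hy, hz⟩, h2⟩⟩
    · refine Finset.mem_union_right _ ?_
      rw [hS₃, Finset.mem_image]
      exact ⟨((z, x), y), Finset.mem_product.2 ⟨mem_badPairs.2 ⟨⟨hz, hx⟩, h3⟩, hy⟩, rfl⟩
  have h1 : S₁.card ≤ Z.card * (badPairs R X Y).card :=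
    Finset.card_image_le.trans (by rw [Finset.card_product, mul_comm])
  have h2 : S₂.card ≤ X.card * (badPairs R Y Z).card := by rw [hS₂, Finset.card_product]
  have h3 : S₃.card ≤ Y.card * (badPairs R Z X).card :=
    Finset.card_image_le.trans (by rw [Finset.card_product, mul_comm])
  calc X.card * Y.card * Z.card = (X ×ˢ Y ×ˢ Z).card := by
        rw [Finset.card_product, Finset.card_product, mul_assoc]
    _ ≤ (S₁ ∪ S₂ ∪ S₃).card := Finset.card_le_card hsub
    _ ≤ S₁.card + S₂.card + S₃.card :=
        (Finset.card_union_le _ _).trans (Nat.add_le_add_right (Finset.card_union_le _ _) _)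
    _ ≤ _ := Nat.add_le_add (Nat.add_le_add h1 h2) h3

/-- From `abc ≤ cβ₁ + aβ₂ + bβ₃` to **`min(ab, bc, ca) ≤ β₁ + β₂ + β₃`**: divide by `max(a, b, c)`
(the minimum of the three pair products is the product of the two smallest sides). So a block all
of whose solutions are met by `R` has `min(|X||Y|, |Y||Z|, |Z||X|)` at most the number of its bad
pairs. [cite: Pratt2024, Cor. 2.9 (proof)] -/
theorem min_le_card_badPairs (R X Y Z : Finset G)
    (h : ∀ x ∈ X, ∀ y ∈ Y, ∀ z ∈ Z, x - y ∈ R ∨ y - z ∈ R ∨ z - x ∈ R) :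
    min (X.card * Y.card) (min (Y.card * Z.card) (Z.card * X.card)) ≤
      (badPairs R X Y).card + (badPairs R Y Z).card + (badPairs R Z X).card := by
  have key := card_mul_le_of_forall_mem R X Y Z h
  set a := X.card
  set b := Y.card
  set c := Z.card
  set β₁ := (badPairs R X Y).card
  set β₂ := (badPairs R Y Z).card
  set β₃ := (badPairs R Z X).card
  set M := max a (max b c) with hM
  rcases Nat.eq_zero_or_pos M with hM0 | hMpos
  · have ha : a = 0 := by omega
    exact (min_le_left _ _).trans (by rw [ha, zero_mul]; exact Nat.zero_le _)
  · have haM : a ≤ M := le_max_left _ _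
    have hbM : b ≤ M := (le_max_left _ _).trans (le_max_right _ _)
    have hcM : c ≤ M := (le_max_right _ _).trans (le_max_right _ _)
    -- `min · M ≤ abc`
    have hmin : min (a * b) (min (b * c) (c * a)) * M ≤ a * b * c := by
      rcases le_total b a with hba | hab
      · rcases le_total c a with hca | hac
        · -- `M = a`
          have hMa : M = a := by rw [hM, max_eq_left (max_le hba hca)]
          calc min (a * b) (min (b * c) (c * a)) * M ≤ (b * c) * a :=
                Nat.mul_le_mul ((min_le_right _ _).trans (min_le_left _ _)) hMa.le
            _ = a * b * c := by ring
        · -- `M = c`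
          have hMc : M = c := by
            rw [hM, max_eq_right (hba.trans hac), max_eq_right hac]
          calc min (a * b) (min (b * c) (c * a)) * M ≤ (a * b) * c :=
                Nat.mul_le_mul (min_le_left _ _) hMc.le
            _ = a * b * c := by ring
      · rcases le_total c b with hcb | hbc
        · -- `M = b`
          have hMb : M = b := by rw [hM, max_eq_right (le_max_of_le_left hab), max_eq_left hcb]
          calc min (a * b) (min (b * c) (c * a)) * M ≤ (c * a) * b :=
                Nat.mul_le_mul ((min_le_right _ _).trans (min_le_right _ _)) hMb.le
            _ = a * b * c := by ring
        · -- `M = c`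
          have hMc : M = c := by
            rw [hM, max_eq_right (hab.trans (le_max_of_le_right hbc)), max_eq_right hbc]
          calc min (a * b) (min (b * c) (c * a)) * M ≤ (a * b) * c :=
                Nat.mul_le_mul (min_le_left _ _) hMc.le
            _ = a * b * c := by ring
    have hup : c * β₁ + a * β₂ + b * β₃ ≤ (β₁ + β₂ + β₃) * M := by
      calc c * β₁ + a * β₂ + b * β₃ ≤ M * β₁ + M * β₂ + M * β₃ :=
            Nat.add_le_add (Nat.add_le_add (Nat.mul_le_mul_right _ hcM)
              (Nat.mul_le_mul_right _ haM)) (Nat.mul_le_mul_right _ hbM)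
        _ = (β₁ + β₂ + β₃) * M := by ring
    exact Nat.le_of_mul_le_mul_right (hmin.trans (key.trans hup)) hMpos

end Blocks

/-! ### STPP families: the solution count and the injectivity of `(i, a, b) ↦ a − b` -/

section Family

variable {G : Type*} [AddCommGroup G] [DecidableEq G] {N : ℕ} {A B C : Fin N → Finset G}

/-- The difference set `X − Y = {x − y}` of a block, as the image of `X × Y`. [folklore] -/
def diffSet (X Y : Finset G) : Finset G := (X ×ˢ Y).image fun q => q.1 - q.2

/-- Membership in `diffSet`. [folklore] -/
theorem mem_diffSet {X Y : Finset G} {d : G} :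
    d ∈ diffSet X Y ↔ ∃ x ∈ X, ∃ y ∈ Y, x - y = d := by
  constructor
  · intro hd
    rw [diffSet, Finset.mem_image] at hd
    obtain ⟨⟨x, y⟩, hq, rfl⟩ := hd
    rw [Finset.mem_product] at hq
    exact ⟨x, hq.1, y, hq.2, rfl⟩
  · rintro ⟨x, hx, y, hy, rfl⟩
    rw [diffSet, Finset.mem_image]
    exact ⟨(x, y), Finset.mem_product.2 ⟨hx, hy⟩, rfl⟩

/-- **The solutions of `d₁ + d₂ + d₃ = 0` in `(⊔ Aᵢ − Bᵢ) × (⊔ Bᵢ − Cᵢ) × (⊔ Cᵢ − Aᵢ)` are the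
triples `(a − b, b − c, c − a)`, `(a, b, c) ∈ Aᵢ × Bᵢ × Cᵢ`** (Pratt, proof of Cor. 2.9: "By
definition of the STPP, the equation `x₁x₂x₃ = I` with `xᵢ ∈ Aᵢ` has `Σ|Xᵢ||Yᵢ||Zᵢ|` solutions"):
for every set `F` of blocks, the number of solutions with `dⱼ` in the unions over `F` is at most
`Σ_{i ∈ F} |Aᵢ||Bᵢ||Cᵢ|`. [cite: Pratt2024, Cor. 2.9 (proof)] -/
theorem card_triangles_le (hS : IsSTPP A B C) (F : Finset (Fin N)) :
    (((F.biUnion fun i => diffSet (A i) (B i)) ×ˢ (F.biUnion fun i => diffSet (B i) (C i)) ×ˢ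
        (F.biUnion fun i => diffSet (C i) (A i))).filter
          (fun t : G × G × G => t.1 + t.2.1 + t.2.2 = 0)).card ≤
      ∑ i ∈ F, (A i).card * (B i).card * (C i).card := by
  classical
  set Φ : (Σ _ : Fin N, G × G × G) → G × G × G :=
    fun q => (q.2.1 - q.2.2.1, q.2.2.1 - q.2.2.2, q.2.2.2 - q.2.1) with hΦ
  have hsub : ((F.biUnion fun i => diffSet (A i) (B i)) ×ˢ (F.biUnion fun i => diffSet (B i) (C i)) ×ˢ
        (F.biUnion fun i => diffSet (C i) (A i))).filter
          (fun t : G × G × G => t.1 + t.2.1 + t.2.2 = 0) ⊆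
      (F.sigma fun i => A i ×ˢ B i ×ˢ C i).image Φ := by
    rintro ⟨x, y, z⟩ ht
    rw [Finset.mem_filter, Finset.mem_product, Finset.mem_product] at ht
    obtain ⟨⟨hx, hy, hz⟩, hsum⟩ := ht
    simp only [Finset.mem_biUnion, mem_diffSet] at hx hy hz
    obtain ⟨i, hi, a, ha, b, hb, rfl⟩ := hx
    obtain ⟨j, -, b', hb', c, hc, rfl⟩ := hy
    obtain ⟨k, -, c', hc', a', ha', rfl⟩ := hz
    have hsum' : (a - b) + (b' - c) + (c' - a') = 0 := hsum
    have hrel : (a - a') + (b' - b) + (c' - c) = 0 := by rw [← hsum']; abel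
    obtain ⟨hij, hjk, h1, h2, h3⟩ := hS i j k a' ha' a ha b hb b' hb' c hc c' hc' hrel
    subst hij; subst hjk; subst h1; subst h2; subst h3
    rw [Finset.mem_image]
    exact ⟨⟨i, a', b, c⟩, Finset.mem_sigma.2 ⟨hi, Finset.mem_product.2
      ⟨ha, Finset.mem_product.2 ⟨hb, hc⟩⟩⟩, rfl⟩
  calc _ ≤ ((F.sigma fun i => A i ×ˢ B i ×ˢ C i).image Φ).card := Finset.card_le_card hsub
    _ ≤ (F.sigma fun i => A i ×ˢ B i ×ˢ C i).card := Finset.card_image_le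
    _ = ∑ i ∈ F, (A i).card * (B i).card * (C i).card := by
        rw [Finset.card_sigma]
        exact Finset.sum_congr rfl fun i _ => by rw [Finset.card_product, Finset.card_product, mul_assoc]

/-- **`(i, a, b) ↦ a − b` is injective on `⊔_{i ∈ F} Aᵢ × Bᵢ` when the `Cᵢ`, `i ∈ F`, are nonempty**
(STPP with `j = k` and `u = u' ∈ C_j`); hence for every `R ⊆ G` the bad pairs of the blocks in `F`
number at most `|R|` in total. With `R = G` this is the packing bound `Σ_{i∈F} |Aᵢ||Bᵢ| ≤ |G|`
(BCCGNSU 2017, §2). [cite: Pratt2024, Prop. 2.3] -/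
theorem sum_card_badPairs_le (hS : IsSTPP A B C) {F : Finset (Fin N)}
    (hF : ∀ i ∈ F, (C i).Nonempty) (R : Finset G) :
    ∑ i ∈ F, (badPairs R (A i) (B i)).card ≤ R.card := by
  classical
  rw [← Finset.card_sigma]
  refine Finset.card_le_card_of_injOn (fun q => q.2.1 - q.2.2) (fun q hq => ?_) ?_
  · rw [Finset.mem_coe, Finset.mem_sigma, mem_badPairs] at hq
    exact hq.2.2
  · rintro ⟨i, a, b⟩ hq ⟨j, a', b'⟩ hq' heq
    rw [Finset.mem_coe, Finset.mem_sigma, mem_badPairs] at hq hq'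
    obtain ⟨hi, ⟨ha, hb⟩, -⟩ := hq
    obtain ⟨hj, ⟨ha', hb'⟩, -⟩ := hq'
    obtain ⟨u, hu⟩ := hF j hj
    have hrel : (a - a') + (b' - b) + (u - u) = 0 := by
      have heq' : a - b = a' - b' := heq
      rw [sub_self, add_zero, ← sub_eq_zero.2 heq']
      abel
    obtain ⟨hij, -, h1, h2, -⟩ := hS i j j a' ha' a ha b hb b' hb' u hu u hu hrel
    subst hij; subst h1; subst h2
    rfl

/-- The packing bound over a set of blocks with nonempty third sets: `Σ_{i∈F} |Aᵢ||Bᵢ| ≤ |G|`.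
[cite: Pratt2024, Prop. 2.3] -/
theorem sum_card_mul_card_le_card (hS : IsSTPP A B C) [Fintype G] {F : Finset (Fin N)}
    (hF : ∀ i ∈ F, (C i).Nonempty) :
    ∑ i ∈ F, (A i).card * (B i).card ≤ Fintype.card G := by
  have h := sum_card_badPairs_le hS hF Finset.univ
  simp only [badPairs_univ, Finset.card_product, Finset.card_univ] at h
  exact h

/-- **`Σᵢ |Aᵢ||Bᵢ||Cᵢ| ≤ n^{3/2}`** over the blocks with all three sets nonempty, `n = |G|` (Pratt,
proof of Cor. 2.9: "by the packing bound […] so by Cauchy–Schwarz there are at most `n^{3/2}`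
solutions"), in the squared integer form `(Σ_{i∈F} |Aᵢ||Bᵢ||Cᵢ|)² ≤ n³`:
`(Σ abc)² ≤ (Σ ab)(Σ ab·c²)` and `ab·c² = (ca)(bc) ≤ n·bc`. [cite: Pratt2024, Cor. 2.9 (proof)] -/
theorem sq_sum_card_mul_le (hS : IsSTPP A B C) [Fintype G] {F : Finset (Fin N)}
    (hFA : ∀ i ∈ F, (A i).Nonempty) (hFB : ∀ i ∈ F, (B i).Nonempty)
    (hFC : ∀ i ∈ F, (C i).Nonempty) :
    (∑ i ∈ F, (A i).card * (B i).card * (C i).card) ^ 2 ≤ Fintype.card G ^ 3 := by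
  set n := Fintype.card G
  have hAB : ∑ i ∈ F, (A i).card * (B i).card ≤ n := sum_card_mul_card_le_card hS hFC
  have hBC : ∑ i ∈ F, (B i).card * (C i).card ≤ n := sum_card_mul_card_le_card hS.rotate hFA
  have hCA : ∑ i ∈ F, (C i).card * (A i).card ≤ n := sum_card_mul_card_le_card hS.rotate.rotate hFB
  have hCAi : ∀ i ∈ F, (C i).card * (A i).card ≤ n := fun i hi =>
    (Finset.single_le_sum (f := fun i => (C i).card * (A i).card) (fun _ _ => Nat.zero_le _) hi).trans
      hCA
  have hCS : (∑ i ∈ F, (A i).card * (B i).card * (C i).card) ^ 2 ≤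
      (∑ i ∈ F, (A i).card * (B i).card) *
        ∑ i ∈ F, (A i).card * (B i).card * (C i).card ^ 2 :=
    Finset.sum_sq_le_sum_mul_sum_of_sq_le_mul F (fun _ _ => Nat.zero_le _)
      (fun _ _ => Nat.zero_le _) (fun i _ => by ring_nf; rfl)
  have hsecond : ∑ i ∈ F, (A i).card * (B i).card * (C i).card ^ 2 ≤ n * n := by
    calc ∑ i ∈ F, (A i).card * (B i).card * (C i).card ^ 2
        = ∑ i ∈ F, ((C i).card * (A i).card) * ((B i).card * (C i).card) :=
          Finset.sum_congr rfl fun i _ => by ring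
      _ ≤ ∑ i ∈ F, n * ((B i).card * (C i).card) :=
          Finset.sum_le_sum fun i hi => Nat.mul_le_mul_right _ (hCAi i hi)
      _ = n * ∑ i ∈ F, (B i).card * (C i).card := by rw [Finset.mul_sum]
      _ ≤ n * n := Nat.mul_le_mul_left _ hBC
  calc (∑ i ∈ F, (A i).card * (B i).card * (C i).card) ^ 2
      ≤ (∑ i ∈ F, (A i).card * (B i).card) *
          ∑ i ∈ F, (A i).card * (B i).card * (C i).card ^ 2 := hCS
    _ ≤ n * (n * n) := Nat.mul_le_mul hAB hsecond
    _ = n ^ 3 := by ring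

/-- **Removal sets are large in the sum-of-minima sense** (the corrected conclusion of Pratt's
argument): if `R ⊆ G` meets every solution `d₁ + d₂ + d₃ = 0`, `d₁ ∈ ⊔_{i∈F}(Aᵢ − Bᵢ)`,
`d₂ ∈ ⊔_{i∈F}(Bᵢ − Cᵢ)`, `d₃ ∈ ⊔_{i∈F}(Cᵢ − Aᵢ)`, over the set `F` of blocks with all three sets
nonempty, then `Σᵢ min(|Aᵢ||Bᵢ|, |Bᵢ||Cᵢ|, |Cᵢ||Aᵢ|) ≤ 3|R|` (blocks outside `F` contribute `0`;
each block in `F` has `min ≤ β₁ + β₂ + β₃` by `min_le_card_badPairs`, and each of the three sums of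
bad-pair counts is `≤ |R|` by `sum_card_badPairs_le` and cyclic symmetry).
[cite: Pratt2024, Cor. 2.9 (proof)] -/
theorem sum_min_le_three_mul_card (hS : IsSTPP A B C) (R : Finset G)
    (hR : ∀ x ∈ (Finset.univ.filter fun i => (A i).Nonempty ∧ (B i).Nonempty ∧ (C i).Nonempty).biUnion
        fun i => diffSet (A i) (B i), x ∉ R →
      ∀ y ∈ (Finset.univ.filter fun i => (A i).Nonempty ∧ (B i).Nonempty ∧ (C i).Nonempty).biUnion
        fun i => diffSet (B i) (C i), y ∉ R →
      ∀ z ∈ (Finset.univ.filter fun i => (A i).Nonempty ∧ (B i).Nonempty ∧ (C i).Nonempty).biUnion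
        fun i => diffSet (C i) (A i), z ∉ R → x + y + z ≠ 0) :
    ∑ i, min ((A i).card * (B i).card) (min ((B i).card * (C i).card) ((C i).card * (A i).card)) ≤
      3 * R.card := by
  classical
  set F := Finset.univ.filter fun i => (A i).Nonempty ∧ (B i).Nonempty ∧ (C i).Nonempty with hF
  have hFA : ∀ i ∈ F, (A i).Nonempty := fun i hi => ((Finset.mem_filter.1 hi).2).1
  have hFB : ∀ i ∈ F, (B i).Nonempty := fun i hi => ((Finset.mem_filter.1 hi).2).2.1
  have hFC : ∀ i ∈ F, (C i).Nonempty := fun i hi => ((Finset.mem_filter.1 hi).2).2.2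
  -- every solution inside a block of `F` is met by `R`
  have hblock : ∀ i ∈ F, ∀ a ∈ A i, ∀ b ∈ B i, ∀ c ∈ C i,
      a - b ∈ R ∨ b - c ∈ R ∨ c - a ∈ R := by
    intro i hi a ha b hb c hc
    by_contra hcon
    simp only [not_or] at hcon
    obtain ⟨h1, h2, h3⟩ := hcon
    have hx : a - b ∈ F.biUnion fun i => diffSet (A i) (B i) :=
      Finset.mem_biUnion.2 ⟨i, hi, mem_diffSet.2 ⟨a, ha, b, hb, rfl⟩⟩
    have hy : b - c ∈ F.biUnion fun i => diffSet (B i) (C i) :=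
      Finset.mem_biUnion.2 ⟨i, hi, mem_diffSet.2 ⟨b, hb, c, hc, rfl⟩⟩
    have hz : c - a ∈ F.biUnion fun i => diffSet (C i) (A i) :=
      Finset.mem_biUnion.2 ⟨i, hi, mem_diffSet.2 ⟨c, hc, a, ha, rfl⟩⟩
    exact hR (a - b) hx h1 (b - c) hy h2 (c - a) hz h3 (by abel)
  -- restrict the sum to `F`
  have hzero : ∀ i ∈ Finset.univ, i ∉ F →
      min ((A i).card * (B i).card) (min ((B i).card * (C i).card) ((C i).card * (A i).card)) = 0 := by
    intro i _ hi
    rw [hF, Finset.mem_filter, not_and] at hi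
    have hi' := hi (Finset.mem_univ i)
    simp only [not_and_or, Finset.not_nonempty_iff_eq_empty] at hi'
    rcases hi' with hA | hB | hC
    · rw [hA, Finset.card_empty, zero_mul, Nat.min_eq_left (Nat.zero_le _)]
    · rw [hB, Finset.card_empty, zero_mul, mul_zero, Nat.min_eq_left (Nat.zero_le _)]
    · rw [hC, Finset.card_empty, zero_mul, mul_zero, Nat.min_zero, Nat.min_zero]
  rw [← Finset.sum_subset (Finset.subset_univ F) hzero]
  calc ∑ i ∈ F, min ((A i).card * (B i).card) (min ((B i).card * (C i).card) ((C i).card * (A i).card))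
      ≤ ∑ i ∈ F, ((badPairs R (A i) (B i)).card + (badPairs R (B i) (C i)).card +
          (badPairs R (C i) (A i)).card) :=
        Finset.sum_le_sum fun i hi => min_le_card_badPairs R (A i) (B i) (C i) (hblock i hi)
    _ = ∑ i ∈ F, (badPairs R (A i) (B i)).card + ∑ i ∈ F, (badPairs R (B i) (C i)).card +
          ∑ i ∈ F, (badPairs R (C i) (A i)).card := by
        rw [Finset.sum_add_distrib, Finset.sum_add_distrib]
    _ ≤ R.card + R.card + R.card :=
        Nat.add_le_add (Nat.add_le_add (sum_card_badPairs_le hS hFC R)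
          (sum_card_badPairs_le hS.rotate hFA R)) (sum_card_badPairs_le hS.rotate.rotate hFB R)
    _ = 3 * R.card := by ring

omit [AddCommGroup G] [DecidableEq G] in
/-- Blocks with an empty set contribute `0` to the sum of minima: the sum over all blocks equals
the sum over the blocks with `Aᵢ, Bᵢ, Cᵢ` all nonempty. [folklore] -/
theorem sum_min_eq_sum_filter (A B C : Fin N → Finset G) :
    ∑ i, min ((A i).card * (B i).card) (min ((B i).card * (C i).card) ((C i).card * (A i).card)) =
      ∑ i ∈ Finset.univ.filter (fun i => (A i).Nonempty ∧ (B i).Nonempty ∧ (C i).Nonempty),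
        min ((A i).card * (B i).card) (min ((B i).card * (C i).card) ((C i).card * (A i).card)) := by
  classical
  refine (Finset.sum_subset (Finset.filter_subset _ _) fun i _ hi => ?_).symm
  rw [Finset.mem_filter, not_and] at hi
  have hi' := hi (Finset.mem_univ i)
  simp only [not_and_or, Finset.not_nonempty_iff_eq_empty] at hi'
  rcases hi' with hA | hB | hC
  · rw [hA, Finset.card_empty, zero_mul, Nat.min_eq_left (Nat.zero_le _)]
  · rw [hB, Finset.card_empty, zero_mul, mul_zero, Nat.min_eq_left (Nat.zero_le _)]
  · rw [hC, Finset.card_empty, zero_mul, mul_zero, Nat.min_zero, Nat.min_zero]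

/-- The trivial bound: `Σᵢ min(|Aᵢ||Bᵢ|, |Bᵢ||Cᵢ|, |Cᵢ||Aᵢ|) ≤ |G|` (`min ≤ |Aᵢ||Bᵢ|` on the blocks
with all sets nonempty, then the packing bound). [cite: Pratt2024, Prop. 2.3] -/
theorem sum_min_le_card (hS : IsSTPP A B C) [Fintype G] :
    ∑ i, min ((A i).card * (B i).card) (min ((B i).card * (C i).card) ((C i).card * (A i).card)) ≤
      Fintype.card G := by
  classical
  rw [sum_min_eq_sum_filter]
  refine (Finset.sum_le_sum fun i _ => min_le_left _ _).trans
    (sum_card_mul_card_le_card hS fun i hi => ((Finset.mem_filter.1 hi).2).2.2)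

end Family

/-! ### The constants `γ`, `L₀`, `K` -/

section Constants

/-- **Pratt's absolute constant** `γ = exp(δ₀ log 2 / (2(δ₀ + log 2))) > 1`, `δ₀ = log((2/3)2^{2/3})`
the constant of BCCGNSU Thm. A′: a uniform lower bound for `p^{1/(2C_p)}` over all primes `p`
(`prattGamma_le_rpow`), where `C_p` is the Fox–Lovász removal exponent. (Print: "for some
universal `C`"; this is one admissible value.) [cite: Pratt2024, Cor. 2.10 (proof)] -/
def prattGamma : ℝ :=
  Real.exp (bccgnsuDelta * Real.log 2 / (2 * (bccgnsuDelta + Real.log 2)))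

/-- The threshold `L₀ = 2 + 2 log 3 / log 2 + 2 log 3 / δ₀` below which (`ℓ ≤ L₀`) the removal
parameter `ε = 3(2/√n)^{1/C_p}` may exceed `1` and the packing bound is used instead. [folklore] -/
def prattL0 : ℝ := 2 + 2 * Real.log 3 / Real.log 2 + 2 * Real.log 3 / bccgnsuDelta

/-- The absolute constant `K = max(18, γ^{L₀})` of the sum-of-minima bound. [folklore] -/
def prattK : ℝ := max 18 (prattGamma ^ prattL0)

/-- `γ > 1`. [folklore] -/
theorem one_lt_prattGamma : 1 < prattGamma := by
  have hδ := bccgnsuDelta_pos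
  have hlog2 : 0 < Real.log 2 := Real.log_pos one_lt_two
  rw [prattGamma, ← Real.exp_zero, Real.exp_lt_exp]
  positivity

/-- **`C_p ≤ 1 + log p / δ₀`** for `p ≥ 2` (from `c_p ≥ δ₀ / log p`,
`bccgnsuDelta_div_log_le_foxLovaszExponent`): the removal exponent is `O(log p)`.
[cite: FoxLovasz2017, §1] -/
theorem foxLovaszRemovalExponent_le {p : ℕ} (hp : 2 ≤ p) :
    foxLovaszRemovalExponent p ≤ 1 + Real.log p / bccgnsuDelta := by
  have hp1 : (1 : ℝ) < p := by exact_mod_cast (show 1 < p by omega)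
  have hlogp : 0 < Real.log p := Real.log_pos hp1
  have hc : bccgnsuDelta / Real.log p ≤ foxLovaszExponent p :=
    bccgnsuDelta_div_log_le_foxLovaszExponent hp
  have hpos : 0 < bccgnsuDelta / Real.log p := div_pos bccgnsuDelta_pos hlogp
  rw [foxLovaszRemovalExponent, add_le_add_iff_left]
  calc 1 / foxLovaszExponent p ≤ 1 / (bccgnsuDelta / Real.log p) :=
        one_div_le_one_div_of_le hpos hc
    _ = Real.log p / bccgnsuDelta := one_div_div _ _

/-- **`γ ≤ p^{1/(2C_p)}`** for every `p ≥ 2`: `log γ = δ₀ log 2/(2(δ₀ + log 2)) ≤ δ₀ log p/(2(δ₀ + log p))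
≤ log p/(2C_p)` (the first by monotonicity of `t ↦ t/(δ₀+t)`, the second by `C_p ≤ (δ₀ + log p)/δ₀`).
This is the uniformity in `p` of Pratt's "`q^{Θ(−n/log q)} ≤ C'^{−n}` for some universal `C'`".
[cite: Pratt2024, Cor. 2.10 (proof)] -/
theorem prattGamma_le_rpow {p : ℕ} (hp : 2 ≤ p) :
    prattGamma ≤ (p : ℝ) ^ (1 / (2 * foxLovaszRemovalExponent p)) := by
  have hp0 : (0 : ℝ) < p := by exact_mod_cast (show 0 < p by omega)
  have hp1 : (1 : ℝ) < p := by exact_mod_cast (show 1 < p by omega)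
  have hlogp : 0 < Real.log p := Real.log_pos hp1
  have hlog2 : 0 < Real.log 2 := Real.log_pos one_lt_two
  have hlog2p : Real.log 2 ≤ Real.log p := Real.log_le_log two_pos (by exact_mod_cast hp)
  have hδ := bccgnsuDelta_pos
  have hC1 : 1 < foxLovaszRemovalExponent p := one_lt_foxLovaszRemovalExponent hp
  have hCle := foxLovaszRemovalExponent_le hp
  set C := foxLovaszRemovalExponent p
  set δ := bccgnsuDelta
  have hC0 : 0 < C := zero_lt_one.trans hC1
  rw [prattGamma, Real.rpow_def_of_pos hp0, Real.exp_le_exp]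
  have step1 : δ * Real.log 2 / (2 * (δ + Real.log 2)) ≤ δ * Real.log p / (2 * (δ + Real.log p)) := by
    rw [div_le_div_iff₀ (by positivity) (by positivity)]
    have h := mul_le_mul_of_nonneg_left hlog2p (mul_self_nonneg δ)
    nlinarith [h]
  have step2 : δ * Real.log p / (2 * (δ + Real.log p)) ≤ Real.log p * (1 / (2 * C)) := by
    rw [mul_one_div, div_le_div_iff₀ (by positivity) (by positivity)]
    have hδC : δ * C ≤ δ + Real.log p := by
      have := mul_le_mul_of_nonneg_left hCle hδ.le
      rwa [mul_add, mul_one, mul_div_cancel₀ _ hδ.ne'] at this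
    have key : 0 ≤ Real.log p * (δ + Real.log p - δ * C) := mul_nonneg hlogp.le (by linarith)
    nlinarith [key]
  exact step1.trans step2

/-- In the regime `ℓ > L₀` the removal parameter is admissible: `θ = (2/√n)^{1/C_p} < 1/3`
(`n = p^ℓ`), i.e. `ε = 3θ < 1`. Indeed `θ ≥ 1/3` would give `√n ≤ 2·3^{C_p}`, i.e.
`ℓ log p ≤ 2 log 2 + 2 C_p log 3 ≤ 2 log 2 + 2 log 3 + (2 log 3/δ₀) log p < ℓ log p`. [folklore] -/
theorem theta_lt_third {p ℓ : ℕ} (hp : 2 ≤ p) (hℓ : prattL0 < ℓ) :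
    (2 / Real.sqrt ((p : ℝ) ^ ℓ)) ^ (1 / foxLovaszRemovalExponent p) < 1 / 3 := by
  have hp0 : (0 : ℝ) < p := by exact_mod_cast (show 0 < p by omega)
  have hp1 : (1 : ℝ) < p := by exact_mod_cast (show 1 < p by omega)
  have hlogp : 0 < Real.log p := Real.log_pos hp1
  have hlog2 : 0 < Real.log 2 := Real.log_pos one_lt_two
  have hlog3 : 0 < Real.log 3 := Real.log_pos (by norm_num)
  have hlog2p : Real.log 2 ≤ Real.log p := Real.log_le_log two_pos (by exact_mod_cast hp)
  have hδ := bccgnsuDelta_pos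
  have hC1 : 1 < foxLovaszRemovalExponent p := one_lt_foxLovaszRemovalExponent hp
  have hCle := foxLovaszRemovalExponent_le hp
  set C := foxLovaszRemovalExponent p
  set δ := bccgnsuDelta
  have hC0 : 0 < C := zero_lt_one.trans hC1
  set n : ℝ := (p : ℝ) ^ ℓ with hn
  have hn0 : 0 < n := by positivity
  have hsq0 : 0 < Real.sqrt n := Real.sqrt_pos.2 hn0
  set θ : ℝ := (2 / Real.sqrt n) ^ (1 / C) with hθ
  have hθC : θ ^ C = 2 / Real.sqrt n := by
    rw [hθ, ← Real.rpow_mul (by positivity), one_div_mul_cancel hC0.ne', Real.rpow_one]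
  by_contra hcon
  rw [not_lt] at hcon
  -- `(1/3)^C ≤ θ^C = 2/√n`, so `√n ≤ 2 · 3^C`
  have h1 : (1 / 3 : ℝ) ^ C ≤ 2 / Real.sqrt n := by
    rw [← hθC]
    exact Real.rpow_le_rpow (by norm_num) hcon hC0.le
  have h3C : 0 < (3 : ℝ) ^ C := Real.rpow_pos_of_pos (by norm_num) C
  have h2 : Real.sqrt n ≤ 2 * (3 : ℝ) ^ C := by
    rw [Real.div_rpow zero_le_one (by norm_num), Real.one_rpow,
      div_le_div_iff₀ h3C hsq0, one_mul] at h1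
    linarith [mul_comm (2 : ℝ) ((3 : ℝ) ^ C)]
  -- logarithms: `ℓ log p ≤ 2 log 2 + 2 C log 3`
  have h3 : (ℓ : ℝ) * Real.log p ≤ 2 * Real.log 2 + 2 * C * Real.log 3 := by
    have hlog := Real.log_le_log hsq0 h2
    rw [Real.log_sqrt hn0.le, hn, Real.log_pow, Real.log_mul two_ne_zero h3C.ne',
      Real.log_rpow (by norm_num)] at hlog
    linarith
  -- but `ℓ > L₀` forces the opposite inequality
  have h4 : 2 * Real.log 2 + 2 * C * Real.log 3 ≤
      2 * Real.log 2 + 2 * Real.log 3 + (2 * Real.log 3 / δ) * Real.log p := by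
    have := mul_le_mul_of_nonneg_right hCle (by positivity : (0 : ℝ) ≤ 2 * Real.log 3)
    calc 2 * Real.log 2 + 2 * C * Real.log 3 = 2 * Real.log 2 + C * (2 * Real.log 3) := by ring
      _ ≤ 2 * Real.log 2 + (1 + Real.log p / δ) * (2 * Real.log 3) := by linarith
      _ = 2 * Real.log 2 + 2 * Real.log 3 + (2 * Real.log 3 / δ) * Real.log p := by ring
  have h5 : 2 * Real.log 2 + 2 * Real.log 3 + (2 * Real.log 3 / δ) * Real.log p <
      (ℓ : ℝ) * Real.log p := by
    have hL : prattL0 * Real.log p < (ℓ : ℝ) * Real.log p := mul_lt_mul_of_pos_right hℓ hlogp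
    have hexp : prattL0 * Real.log p =
        2 * Real.log p + (2 * Real.log 3 / Real.log 2) * Real.log p +
          (2 * Real.log 3 / δ) * Real.log p := by
      rw [prattL0]; ring
    have ha : 2 * Real.log 2 ≤ 2 * Real.log p := by linarith
    have hb : 2 * Real.log 3 ≤ (2 * Real.log 3 / Real.log 2) * Real.log p := by
      rw [div_mul_eq_mul_div, le_div_iff₀ hlog2]
      exact mul_le_mul_of_nonneg_left hlog2p (by positivity)
    linarith
  linarith

end Constants

/-! ### The main theorem -/

section Main

/-- **Pratt 2024, Cor. 2.10 — corrected (sum of blockwise minima), for primes, conditional on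
Fox–Lovász tight removal.** Assume `FoxLovasz2017_thm1` (Fox–Lovász 2017, Thm. 1, as printed: in
`𝔽_pⁿ`, fewer than `(ε/3)^{C_p} N²` triangles can be destroyed by removing `εN` elements). Then with
the absolute constants `γ = prattGamma > 1` and `K = prattK`: for every prime `p`, every `ℓ` and every
STPP family `(Aᵢ, Bᵢ, Cᵢ)_{i<N}` of subsets of `𝔽_p^ℓ`,
`Σᵢ min(|Aᵢ||Bᵢ|, |Bᵢ||Cᵢ|, |Cᵢ||Aᵢ|) ≤ K (p/γ)^ℓ`.
Proof (Pratt, p. 6, with the pigeonhole step replaced by the blockwise union bound): for `ℓ ≤ L₀`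
the packing bound `≤ p^ℓ ≤ γ^{L₀}(p/γ)^ℓ`; for `ℓ > L₀` apply removal to
`(⊔(Aᵢ−Bᵢ), ⊔(Bᵢ−Cᵢ), ⊔(Cᵢ−Aᵢ))` (over blocks with nonempty sets) with `ε = 3(2/√n)^{1/C_p} < 1`,
legitimate since the number of solutions is `≤ n^{3/2} < 2n^{3/2} = (ε/3)^{C_p} n²`; the removal set
has `Σ min ≤ 3|R| ≤ 3εn ≤ 18 n^{1−1/(2C_p)} ≤ 18 (p/γ)^ℓ`. The printed Cor. 2.10 (one FULL packing sum
small) does not follow and is false (`TightTriangleRemovalProofs.lean`); the prime-power version of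
this theorem needs the prime-power removal lemma of Pratt's footnote 1 (not in print).
[cite: Pratt2024, Cor. 2.10] [cite: FoxLovasz2017, Thm. 1] -/
theorem sum_min_packing_le_of_foxLovasz_explicit (hFL : FoxLovasz2017_thm1) {p : ℕ} (hp : p.Prime)
    (ℓ N : ℕ) (A B C : Fin N → Finset (Fin ℓ → ZMod p)) (hS : IsSTPP A B C) :
    (∑ i, ((min ((A i).card * (B i).card)
        (min ((B i).card * (C i).card) ((C i).card * (A i).card)) : ℕ) : ℝ)) ≤
      prattK * ((p : ℝ) / prattGamma) ^ ℓ := by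
  classical
  haveI : NeZero p := ⟨hp.ne_zero⟩
  have hγ1 : 1 < prattGamma := one_lt_prattGamma
  have hγ0 : 0 < prattGamma := zero_lt_one.trans hγ1
  have hp2 : 2 ≤ p := hp.two_le
  have hp0 : (0 : ℝ) < p := by exact_mod_cast hp.pos
  have hp1 : (1 : ℝ) < p := by exact_mod_cast hp.one_lt
  set n : ℝ := (p : ℝ) ^ ℓ with hn
  have hn0 : 0 < n := by positivity
  have hcardG : (Fintype.card (Fin ℓ → ZMod p) : ℝ) = n := by
    rw [Fintype.card_fun, ZMod.card, Fintype.card_fin]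
    push_cast
    rfl
  have hKpos : (0 : ℝ) ≤ ((p : ℝ) / prattGamma) ^ ℓ := by positivity
  have hK18 : (18 : ℝ) ≤ prattK := le_max_left _ _
  by_cases hℓ : (ℓ : ℝ) ≤ prattL0
  · -- small `ℓ`: the packing bound
    have h1 := sum_min_le_card hS (G := Fin ℓ → ZMod p)
    have hγℓ : prattGamma ^ ℓ ≤ prattK := by
      calc prattGamma ^ ℓ = prattGamma ^ (ℓ : ℝ) := (Real.rpow_natCast prattGamma ℓ).symm
        _ ≤ prattGamma ^ prattL0 := Real.rpow_le_rpow_of_exponent_le hγ1.le hℓ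
        _ ≤ prattK := le_max_right _ _
    have h2 : n ≤ prattK * ((p : ℝ) / prattGamma) ^ ℓ := by
      rw [div_pow, mul_div_assoc', le_div_iff₀ (by positivity), ← hn]
      calc n * prattGamma ^ ℓ ≤ n * prattK := mul_le_mul_of_nonneg_left hγℓ hn0.le
        _ = prattK * n := mul_comm _ _
    calc (_ : ℝ) ≤ (Fintype.card (Fin ℓ → ZMod p) : ℝ) := by exact_mod_cast h1
      _ = n := hcardG
      _ ≤ _ := h2
  · -- large `ℓ`: removal
    have hℓ' : prattL0 < ℓ := lt_of_not_ge hℓ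
    set Cp := foxLovaszRemovalExponent p with hCp
    have hC1 : 1 < Cp := one_lt_foxLovaszRemovalExponent hp2
    have hC0 : 0 < Cp := zero_lt_one.trans hC1
    have hsq0 : 0 < Real.sqrt n := Real.sqrt_pos.2 hn0
    set θ : ℝ := (2 / Real.sqrt n) ^ (1 / Cp) with hθ
    have hθ0 : 0 < θ := Real.rpow_pos_of_pos (by positivity) _
    have hθC : θ ^ Cp = 2 / Real.sqrt n := by
      rw [hθ, ← Real.rpow_mul (by positivity), one_div_mul_cancel hC0.ne', Real.rpow_one]
    have hθlt : θ < 1 / 3 := theta_lt_third hp2 hℓ'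
    set ε : ℝ := 3 * θ with hε
    have hε0 : 0 < ε := by positivity
    have hε1 : ε < 1 := by rw [hε]; linarith
    -- the blocks with nonempty sets and the three unions of difference sets
    set F : Finset (Fin N) :=
      Finset.univ.filter fun i => (A i).Nonempty ∧ (B i).Nonempty ∧ (C i).Nonempty with hF
    have hFA : ∀ i ∈ F, (A i).Nonempty := fun i hi => ((Finset.mem_filter.1 hi).2).1
    have hFB : ∀ i ∈ F, (B i).Nonempty := fun i hi => ((Finset.mem_filter.1 hi).2).2.1
    have hFC : ∀ i ∈ F, (C i).Nonempty := fun i hi => ((Finset.mem_filter.1 hi).2).2.2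
    set D₁ : Finset (Fin ℓ → ZMod p) := F.biUnion fun i => diffSet (A i) (B i) with hD₁
    set D₂ : Finset (Fin ℓ → ZMod p) := F.biUnion fun i => diffSet (B i) (C i) with hD₂
    set D₃ : Finset (Fin ℓ → ZMod p) := F.biUnion fun i => diffSet (C i) (A i) with hD₃
    -- few solutions: `T ≤ Σ|A||B||C| ≤ n^{3/2} < 2 n^{3/2} = (ε/3)^C n²`
    have hSle : ((∑ i ∈ F, (A i).card * (B i).card * (C i).card : ℕ) : ℝ) ≤ n * Real.sqrt n := by
      have h2 := sq_sum_card_mul_le hS hFA hFB hFC (G := Fin ℓ → ZMod p)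
      have h2' : ((∑ i ∈ F, (A i).card * (B i).card * (C i).card : ℕ) : ℝ) ^ 2 ≤ n ^ 3 := by
        rw [← hcardG]
        exact_mod_cast h2
      have h3 : n ^ 3 = (n * Real.sqrt n) ^ 2 := by
        rw [mul_pow, Real.sq_sqrt hn0.le]; ring
      rw [h3] at h2'
      exact le_of_pow_le_pow_left₀ two_ne_zero (by positivity) h2'
    have hT : ((((D₁ ×ˢ D₂ ×ˢ D₃).filter
        fun t : (Fin ℓ → ZMod p) × (Fin ℓ → ZMod p) × (Fin ℓ → ZMod p) =>
          t.1 + t.2.1 + t.2.2 = 0).card : ℕ) : ℝ) <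
        (ε / 3) ^ foxLovaszRemovalExponent p * ((p : ℝ) ^ ℓ) ^ 2 := by
      have h1 := card_triangles_le hS F
      have hε3 : ε / 3 = θ := by rw [hε]; ring
      have hrhs : 2 / Real.sqrt n * n ^ 2 = 2 * (n * Real.sqrt n) := by
        have hns : n = Real.sqrt n * Real.sqrt n := (Real.mul_self_sqrt hn0.le).symm
        field_simp
        nlinarith [hns]
      rw [hε3, ← hCp, hθC, ← hn, hrhs]
      calc (_ : ℝ) ≤ ((∑ i ∈ F, (A i).card * (B i).card * (C i).card : ℕ) : ℝ) := by
            exact_mod_cast h1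
        _ ≤ n * Real.sqrt n := hSle
        _ < 2 * (n * Real.sqrt n) := by nlinarith [mul_pos hn0 hsq0]
    obtain ⟨R, hRcard, hR⟩ := hFL p hp ℓ ε hε0 hε1 D₁ D₂ D₃ hT
    have hmain := sum_min_le_three_mul_card hS R hR
    -- `θ n ≤ 2 n^{1 − 1/(2C)} ≤ 2 (p/γ)^ℓ`
    have hθle : θ ≤ 2 * n ^ (-(1 / (2 * Cp))) := by
      have h2C : (2 : ℝ) ^ (1 / Cp) ≤ 2 := by
        calc (2 : ℝ) ^ (1 / Cp) ≤ (2 : ℝ) ^ (1 : ℝ) :=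
              Real.rpow_le_rpow_of_exponent_le one_le_two ((div_le_one hC0).2 hC1.le)
          _ = 2 := Real.rpow_one 2
      have hsqC : (Real.sqrt n) ^ (1 / Cp) = n ^ (1 / (2 * Cp)) := by
        rw [Real.sqrt_eq_rpow, ← Real.rpow_mul hn0.le]
        congr 1
        field_simp
      rw [hθ, Real.div_rpow zero_le_two (Real.sqrt_nonneg n), hsqC, Real.rpow_neg hn0.le,
        div_eq_mul_inv]
      exact mul_le_mul_of_nonneg_right h2C (inv_nonneg.2 (Real.rpow_nonneg hn0.le _))
    have hθn : θ * n ≤ 2 * ((p : ℝ) / prattGamma) ^ ℓ := by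
      have hpow : n ^ (-(1 / (2 * Cp))) * n = ((p : ℝ) ^ (1 - 1 / (2 * Cp))) ^ ℓ := by
        have e1 : n ^ (-(1 / (2 * Cp))) * n = n ^ (1 - 1 / (2 * Cp)) := by
          conv_lhs => rw [show n ^ (-(1 / (2 * Cp))) * n = n ^ (-(1 / (2 * Cp))) * n ^ (1 : ℝ) by
            rw [Real.rpow_one]]
          rw [← Real.rpow_add hn0]
          ring_nf
        rw [e1, hn, ← Real.rpow_natCast (p : ℝ) ℓ, ← Real.rpow_mul hp0.le, mul_comm,
          Real.rpow_mul hp0.le, Real.rpow_natCast]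
      have hbase : (p : ℝ) ^ (1 - 1 / (2 * Cp)) ≤ (p : ℝ) / prattGamma := by
        rw [Real.rpow_sub hp0, Real.rpow_one]
        exact div_le_div_of_nonneg_left hp0.le hγ0 (prattGamma_le_rpow hp2)
      have hbase0 : 0 ≤ (p : ℝ) ^ (1 - 1 / (2 * Cp)) := Real.rpow_nonneg hp0.le _
      calc θ * n ≤ 2 * n ^ (-(1 / (2 * Cp))) * n := mul_le_mul_of_nonneg_right hθle hn0.le
        _ = 2 * ((p : ℝ) ^ (1 - 1 / (2 * Cp))) ^ ℓ := by rw [mul_assoc, hpow]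
        _ ≤ 2 * ((p : ℝ) / prattGamma) ^ ℓ :=
            mul_le_mul_of_nonneg_left (pow_le_pow_left₀ hbase0 hbase ℓ) zero_le_two
    -- assemble
    calc (_ : ℝ) ≤ ((3 * R.card : ℕ) : ℝ) := by exact_mod_cast hmain
      _ = 3 * (R.card : ℝ) := by push_cast; ring
      _ ≤ 3 * (ε * (p : ℝ) ^ ℓ) := by linarith
      _ = 9 * (θ * n) := by rw [hε, hn]; ring
      _ ≤ 9 * (2 * ((p : ℝ) / prattGamma) ^ ℓ) := by linarith
      _ = 18 * ((p : ℝ) / prattGamma) ^ ℓ := by ring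
      _ ≤ prattK * ((p : ℝ) / prattGamma) ^ ℓ := mul_le_mul_of_nonneg_right hK18 hKpos

/-- **Pratt 2024, Cor. 2.10 — corrected (sum of blockwise minima), for primes, conditional on
Fox–Lovász tight removal**, in the `∃ γ > 1, ∃ K` form parallel to the (refuted) vendored statement
`Pratt2024_cor210`: assuming `FoxLovasz2017_thm1`, there are absolute `γ > 1` and `K` such that for
every prime `p`, every `ℓ` and every STPP family in `𝔽_p^ℓ`,
`Σᵢ min(|Aᵢ||Bᵢ|, |Bᵢ||Cᵢ|, |Cᵢ||Aᵢ|) ≤ K (p/γ)^ℓ` (`γ = prattGamma`, `K = prattK`).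
[cite: Pratt2024, Cor. 2.10] [cite: FoxLovasz2017, Thm. 1] -/
theorem sum_min_packing_le_of_foxLovasz (hFL : FoxLovasz2017_thm1) :
    ∃ γ : ℝ, 1 < γ ∧ ∃ K : ℝ, ∀ p ℓ : ℕ, p.Prime →
      ∀ (N : ℕ) (A B C : Fin N → Finset (Fin ℓ → ZMod p)), IsSTPP A B C →
        (∑ i, ((min ((A i).card * (B i).card)
            (min ((B i).card * (C i).card) ((C i).card * (A i).card)) : ℕ) : ℝ)) ≤
          K * ((p : ℝ) / γ) ^ ℓ :=
  ⟨prattGamma, one_lt_prattGamma, prattK, fun _ ℓ hp N A B C hS =>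
    sum_min_packing_le_of_foxLovasz_explicit hFL hp ℓ N A B C hS⟩

/-- **Pratt 2024, Cor. 2.10 AS PRINTED holds for uniform families in `𝔽_p^ℓ`** (conditional on
Fox–Lovász): assuming `FoxLovasz2017_thm1`, with `γ = prattGamma`, `K = prattK`, for every prime `p`,
every `ℓ` and every STPP family in `𝔽_p^ℓ` whose blocks all have the same shape (`|Aᵢ| = a`,
`|Bᵢ| = b`, `|Cᵢ| = c`), one of the three full packing sums `Σ|Aᵢ||Bᵢ|`, `Σ|Bᵢ||Cᵢ|`, `Σ|Cᵢ||Aᵢ|` is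
at most `K (p/γ)^ℓ` (`sum_min_packing_le_of_foxLovasz_explicit` + `packing_disj_of_sum_min_le`). The
uniformity hypothesis cannot be dropped (`not_Pratt2024_cor210`).
[cite: Pratt2024, Cor. 2.10] [cite: FoxLovasz2017, Thm. 1] -/
theorem packing_disj_of_uniform_of_foxLovasz (hFL : FoxLovasz2017_thm1) :
    ∃ γ : ℝ, 1 < γ ∧ ∃ K : ℝ, ∀ p ℓ : ℕ, p.Prime →
      ∀ (N : ℕ) (A B C : Fin N → Finset (Fin ℓ → ZMod p)), IsSTPP A B C →
        (∃ a b c : ℕ, ∀ i, (A i).card = a ∧ (B i).card = b ∧ (C i).card = c) →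
          (∑ i, (((A i).card * (B i).card : ℕ) : ℝ) ≤ K * ((p : ℝ) / γ) ^ ℓ) ∨
          (∑ i, (((B i).card * (C i).card : ℕ) : ℝ) ≤ K * ((p : ℝ) / γ) ^ ℓ) ∨
          (∑ i, (((C i).card * (A i).card : ℕ) : ℝ) ≤ K * ((p : ℝ) / γ) ^ ℓ) :=
  ⟨prattGamma, one_lt_prattGamma, prattK, fun _ ℓ hp N A B C hS huni =>
    packing_disj_of_sum_min_le huni (sum_min_packing_le_of_foxLovasz_explicit hFL hp ℓ N A B C hS)⟩

end Main

end Literature.Combinatorics.Additive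

end
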